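import Mathlib
import HarnessLib
import Literature.Analysis.FluidPDE.VectorCalculus
import Literature.Analysis.FluidPDE.VorticityCalculus
import Literature.Analysis.FluidPDE.AxisymHouLiVariables
import Summits.NavierStokesRegularity.NavierStokesRegularity.Theorems.PoloidalWindowDoorPoloidalWindowRigidityConstantShearMeans
import Summits.NavierStokesRegularity.NavierStokesRegularity.Theorems.PoloidalWindowDoorPoloidalWindowRigidityClebsch
import Summits.NavierStokesRegularity.NavierStokesRegularity.Theorems.PoloidalWindowDoorPoloidalWindowRigidityFirstIntegral

/-!
# Route `PoloidalWindowDoor`, crux `PoloidalWindowRigidity` (K2, stmt-NavierStokesRegularity-19708) —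
# 2-JET TENSOR STRUCTURE AT A THREAD: the shear Jacobian `M` and the velocity Hessian `H` (part A of
# stub Z1 `stub_threadZeroStructure`, line `centre_type`, ns-idea-8 g6)

Cell ns-regularity-ideate, seat ns-poloidal-K2-p2 g11 (stub-worker on K2; `--supports` the crux item).

Pointwise algebra of second derivatives of a poloidal divergence-free field `V : ℝ³ → ℝ³` at a point `x`
where the vertical shear `∂_z V_h(x)` and the horizontal gradient `∇_h V₂(x)` both vanish (the thread pins of
`stub_loopTangencyPin` and of the hot spot).  With `M_ab := ∂_b∂_z V_a(x)` and `H_ab := ∂_b∂_a V₂(x)`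
(`a, b ∈ {0,1}`; all derivatives as nested `fderiv`s, the convention of the crux lines):

* `fderiv_fderiv_apply_symm` — symmetry of second partials of a component of a `C²` field;
* `shearJacobian_symm` — (i) `M₀₁ = M₁₀` from `ω₂ = ∂₀V₁ − ∂₁V₀ ≡ 0`;
* `shearJacobian_trace` — (ii) `M₀₀ + M₁₁ = −∂_z²V₂(x)` from `div V ≡ 0`;
* `fderiv_fderiv_mul_of_eq_zero` — `D²(gh)(x)[y,y] = 2·Dg(x)y·Dh(x)y` at a common zero of `g, h`;
* `det_shear_hessian_apply_eq_zero` — the frozen law `∂_zV₀·∂₁V₂ − ∂_zV₁·∂₀V₂ ≡ 0` differentiated twice at the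
  double zero: `det[My, Hy] = 0` for every direction `y`;
* `linearDependent_of_minors` — two vectors of `ℝ³` with vanishing `2×2` minors are linearly dependent;
* `shear_hessian_dependent` — (iii) `∃ (c₁,c₂) ≠ 0, c₁·M = c₂·H` (on the `2×2` horizontal blocks);
* `threadZeroStructure_partA` — (i) ∧ (ii) ∧ (iii) for the slice `v(−1)` of a poloidal profile of the route's
  Type-I class at a thread (hypotheses of `stub_threadZeroStructure` minus the ones only part B uses).

WHAT THIS IS NOT: not a claim about Navier–Stokes regularity, not K2 — kinematic 2-jet identities at the hot spot
of a HYPOTHETICAL poloidal Type-I blow-up profile (part A of one provable stub of an ideator line; part B, the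
no-X-point inequality `det(H − M) ≥ 0`, is a separate file).  bears_on LADDER-NS N0, rung N0-LocalTubeDoorPoloidal.
-/

noncomputable section

-- the summit and its single sub-problem share the name (CONVENTIONS §1), as in every Theorems file
set_option linter.dupNamespace false

namespace Summit.NavierStokesRegularity.NavierStokesRegularity.Theorems.PoloidalWindowDoorPoloidalWindowRigidityThreadShearHessian

open MeasureTheory Set Function Filter Topology Metric
open scoped RealInnerProductSpace InnerProductSpace
open Literature.Analysis Literature.Analysis.FluidPDE
open Summit.NavierStokesRegularity.NavierStokesRegularity.Theorems.PoloidalWindowDoorPoloidalWindowRigidityConstantShearMeans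
open Summit.NavierStokesRegularity.NavierStokesRegularity.Theorems.PoloidalWindowDoorPoloidalWindowRigidityWindow
open Summit.NavierStokesRegularity.NavierStokesRegularity.Theorems.PoloidalWindowDoorPoloidalWindowRigidityFirstIntegral

/-! ### Second partials of a component of a field -/

variable {V : EuclideanSpace ℝ (Fin 3) → EuclideanSpace ℝ (Fin 3)}

/-- Symmetry of second partials of a component of a `C²` field: `∂_b(∂_a V)_i = ∂_a(∂_b V)_i`. -/
theorem fderiv_fderiv_apply_symm (hV : ContDiff ℝ 2 V) (x a b : EuclideanSpace ℝ (Fin 3)) (i : Fin 3) :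
    fderiv ℝ (fun y => fderiv ℝ V y a i) x b = fderiv ℝ (fun y => fderiv ℝ V y b i) x a := by
  have hd : Differentiable ℝ V := hV.differentiable two_ne_zero
  have h : ∀ c : EuclideanSpace ℝ (Fin 3),
      (fun y => fderiv ℝ V y c i) = fun y => fderiv ℝ (fun z => V z i) y c :=
    fun c => funext fun y => (fderiv_coord_apply (hd y) i c).symm
  rw [h a, h b]
  exact fderiv_fderiv_symm (contDiff_coord hV i) x a b

/-- A first partial `y ↦ (DV(y) a)_i` of a `Cⁿ⁺¹` field is `Cⁿ`. -/
theorem contDiff_fderiv_apply_coord {n : ℕ∞} (hV : ContDiff ℝ (n + 1) V) (a : EuclideanSpace ℝ (Fin 3))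
    (i : Fin 3) : ContDiff ℝ n fun y => fderiv ℝ V y a i :=
  contDiff_apply_coord_vec3 (contDiff_fderiv_apply_const_succ hV a) i

/-! ### (i) symmetry and (ii) trace of the shear Jacobian -/

/-- **(i) The horizontal Jacobian of the vertical shear is symmetric** where `ω₂ ≡ 0`:
`∂₁∂_z V₀ = ∂₀∂_z V₁` (differentiate `∂₀V₁ = ∂₁V₀` in `z` and swap the partials). -/
theorem shearJacobian_symm (hV : ContDiff ℝ 2 V)
    (hpol : ∀ y, fderiv ℝ V y (EuclideanSpace.single 0 1) 1 = fderiv ℝ V y (EuclideanSpace.single 1 1) 0)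
    (x : EuclideanSpace ℝ (Fin 3)) :
    fderiv ℝ (fun y => fderiv ℝ V y (EuclideanSpace.single 2 1) 0) x (EuclideanSpace.single 1 1) =
      fderiv ℝ (fun y => fderiv ℝ V y (EuclideanSpace.single 2 1) 1) x (EuclideanSpace.single 0 1) := by
  rw [fderiv_fderiv_apply_symm hV x (EuclideanSpace.single 2 1) (EuclideanSpace.single 1 1) 0,
    fderiv_fderiv_apply_symm hV x (EuclideanSpace.single 2 1) (EuclideanSpace.single 0 1) 1]
  have hfun : (fun y => fderiv ℝ V y (EuclideanSpace.single 1 1) 0) =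
      fun y => fderiv ℝ V y (EuclideanSpace.single 0 1) 1 := funext fun y => (hpol y).symm
  rw [hfun]

/-- **(ii) The trace of the shear Jacobian** of a divergence-free `C²` field:
`∂₀∂_z V₀ + ∂₁∂_z V₁ = −∂_z∂_z V₂` (differentiate `div V = 0` in `z` and swap the partials). -/
theorem shearJacobian_trace (hV : ContDiff ℝ 2 V) (hdiv : VectorCalculus.IsDivFree V)
    (x : EuclideanSpace ℝ (Fin 3)) :
    fderiv ℝ (fun y => fderiv ℝ V y (EuclideanSpace.single 2 1) 0) x (EuclideanSpace.single 0 1) +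
        fderiv ℝ (fun y => fderiv ℝ V y (EuclideanSpace.single 2 1) 1) x (EuclideanSpace.single 1 1) =
      -fderiv ℝ (fun y => fderiv ℝ V y (EuclideanSpace.single 2 1) 2) x (EuclideanSpace.single 2 1) := by
  rw [fderiv_fderiv_apply_symm hV x (EuclideanSpace.single 2 1) (EuclideanSpace.single 0 1) 0,
    fderiv_fderiv_apply_symm hV x (EuclideanSpace.single 2 1) (EuclideanSpace.single 1 1) 1]
  have h := fderiv_divergence_components_eq_zero hV hdiv x (EuclideanSpace.single 2 1)
  linarith

/-! ### (iii) the frozen law at a double zero -/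

/-- **Second derivative of a product at a common zero**: for `C²` scalars `g, h` with `g x = h x = 0`,
`D²(gh)(x)[y,y] = 2·(Dg(x)y)(Dh(x)y)` (nested-`fderiv` form). -/
theorem fderiv_fderiv_mul_of_eq_zero {E : Type*} [NormedAddCommGroup E] [NormedSpace ℝ E]
    {g h : E → ℝ} (hg : ContDiff ℝ 2 g) (hh : ContDiff ℝ 2 h) {x : E} (hg0 : g x = 0) (hh0 : h x = 0)
    (y : E) :
    fderiv ℝ (fun z => fderiv ℝ (fun w => g w * h w) z y) x y = 2 * (fderiv ℝ g x y * fderiv ℝ h x y) := by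
  have hgd : Differentiable ℝ g := hg.differentiable two_ne_zero
  have hhd : Differentiable ℝ h := hh.differentiable two_ne_zero
  have hDg : Differentiable ℝ fun z => fderiv ℝ g z y :=
    ((hg.fderiv_right (m := 1) (by norm_num)).clm_apply contDiff_const).differentiable one_ne_zero
  have hDh : Differentiable ℝ fun z => fderiv ℝ h z y :=
    ((hh.fderiv_right (m := 1) (by norm_num)).clm_apply contDiff_const).differentiable one_ne_zero
  have h1 : (fun z => fderiv ℝ (fun w => g w * h w) z y) =
      fun z => g z * fderiv ℝ h z y + h z * fderiv ℝ g z y := by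
    funext z
    rw [fderiv_fun_mul (hgd z) (hhd z)]
    simp only [_root_.add_apply, FunLike.coe_smul, Pi.smul_apply, smul_eq_mul]
  have hd1 : DifferentiableAt ℝ (fun z => g z * fderiv ℝ h z y) x := (hgd x).mul (hDh x)
  have hd2 : DifferentiableAt ℝ (fun z => h z * fderiv ℝ g z y) x := (hhd x).mul (hDg x)
  rw [h1, fderiv_fun_add hd1 hd2, _root_.add_apply, fderiv_fun_mul (hgd x) (hDh x),
    fderiv_fun_mul (hhd x) (hDg x)]
  simp only [_root_.add_apply, FunLike.coe_smul, Pi.smul_apply, smul_eq_mul, hg0, hh0, zero_mul, zero_add]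
  ring

/-- **The frozen law at a double zero.**  If `∂_zV₀·∂₁V₂ − ∂_zV₁·∂₀V₂ ≡ 0` (`V ∈ C³`) and all four factors
vanish at `x`, then for every direction `y`: `det[My, Hy] = (∂_y∂_zV₀)(∂_y∂₁V₂) − (∂_y∂_zV₁)(∂_y∂₀V₂) = 0`. -/
theorem det_shear_hessian_apply_eq_zero (hV : ContDiff ℝ 3 V)
    (hfrozen : ∀ y, fderiv ℝ V y (EuclideanSpace.single 2 1) 0 * fderiv ℝ V y (EuclideanSpace.single 1 1) 2 -
      fderiv ℝ V y (EuclideanSpace.single 2 1) 1 * fderiv ℝ V y (EuclideanSpace.single 0 1) 2 = 0)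
    {x : EuclideanSpace ℝ (Fin 3)}
    (hp0 : fderiv ℝ V x (EuclideanSpace.single 2 1) 0 = 0) (hp1 : fderiv ℝ V x (EuclideanSpace.single 2 1) 1 = 0)
    (hq0 : fderiv ℝ V x (EuclideanSpace.single 0 1) 2 = 0) (hq1 : fderiv ℝ V x (EuclideanSpace.single 1 1) 2 = 0)
    (y : EuclideanSpace ℝ (Fin 3)) :
    fderiv ℝ (fun z => fderiv ℝ V z (EuclideanSpace.single 2 1) 0) x y *
        fderiv ℝ (fun z => fderiv ℝ V z (EuclideanSpace.single 1 1) 2) x y -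
      fderiv ℝ (fun z => fderiv ℝ V z (EuclideanSpace.single 2 1) 1) x y *
        fderiv ℝ (fun z => fderiv ℝ V z (EuclideanSpace.single 0 1) 2) x y = 0 := by
  have hV3 : ContDiff ℝ ((2 : ℕ∞) + 1) V := by exact_mod_cast hV
  have hp0c : ContDiff ℝ 2 fun z => fderiv ℝ V z (EuclideanSpace.single 2 1) 0 :=
    contDiff_fderiv_apply_coord hV3 _ 0
  have hp1c : ContDiff ℝ 2 fun z => fderiv ℝ V z (EuclideanSpace.single 2 1) 1 :=
    contDiff_fderiv_apply_coord hV3 _ 1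
  have hq0c : ContDiff ℝ 2 fun z => fderiv ℝ V z (EuclideanSpace.single 0 1) 2 :=
    contDiff_fderiv_apply_coord hV3 _ 2
  have hq1c : ContDiff ℝ 2 fun z => fderiv ℝ V z (EuclideanSpace.single 1 1) 2 :=
    contDiff_fderiv_apply_coord hV3 _ 2
  -- the two products and their first derivatives along `y`
  have hA : ContDiff ℝ 2 fun z => fderiv ℝ V z (EuclideanSpace.single 2 1) 0 *
      fderiv ℝ V z (EuclideanSpace.single 1 1) 2 := hp0c.mul hq1c
  have hB : ContDiff ℝ 2 fun z => fderiv ℝ V z (EuclideanSpace.single 2 1) 1 *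
      fderiv ℝ V z (EuclideanSpace.single 0 1) 2 := hp1c.mul hq0c
  have hDA : Differentiable ℝ fun z => fderiv ℝ (fun w => fderiv ℝ V w (EuclideanSpace.single 2 1) 0 *
      fderiv ℝ V w (EuclideanSpace.single 1 1) 2) z y :=
    ((hA.fderiv_right (m := 1) (by norm_num)).clm_apply contDiff_const).differentiable one_ne_zero
  have hDB : Differentiable ℝ fun z => fderiv ℝ (fun w => fderiv ℝ V w (EuclideanSpace.single 2 1) 1 *
      fderiv ℝ V w (EuclideanSpace.single 0 1) 2) z y :=
    ((hB.fderiv_right (m := 1) (by norm_num)).clm_apply contDiff_const).differentiable one_ne_zero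
  -- the frozen law as a function identity, and its first derivative along `y`
  have hF : (fun z => fderiv ℝ (fun w => fderiv ℝ V w (EuclideanSpace.single 2 1) 0 *
        fderiv ℝ V w (EuclideanSpace.single 1 1) 2 -
      fderiv ℝ V w (EuclideanSpace.single 2 1) 1 * fderiv ℝ V w (EuclideanSpace.single 0 1) 2) z y) =
      fun _ => (0 : ℝ) := by
    funext z
    have hz : (fun w => fderiv ℝ V w (EuclideanSpace.single 2 1) 0 * fderiv ℝ V w (EuclideanSpace.single 1 1) 2 -
        fderiv ℝ V w (EuclideanSpace.single 2 1) 1 * fderiv ℝ V w (EuclideanSpace.single 0 1) 2) =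
        fun _ => (0 : ℝ) := funext hfrozen
    rw [hz]
    simp
  have hsplit : (fun z => fderiv ℝ (fun w => fderiv ℝ V w (EuclideanSpace.single 2 1) 0 *
        fderiv ℝ V w (EuclideanSpace.single 1 1) 2 -
      fderiv ℝ V w (EuclideanSpace.single 2 1) 1 * fderiv ℝ V w (EuclideanSpace.single 0 1) 2) z y) =
      fun z => fderiv ℝ (fun w => fderiv ℝ V w (EuclideanSpace.single 2 1) 0 *
          fderiv ℝ V w (EuclideanSpace.single 1 1) 2) z y -
        fderiv ℝ (fun w => fderiv ℝ V w (EuclideanSpace.single 2 1) 1 *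
          fderiv ℝ V w (EuclideanSpace.single 0 1) 2) z y := by
    funext z
    rw [fderiv_fun_sub ((hA.differentiable two_ne_zero) z) ((hB.differentiable two_ne_zero) z),
      _root_.sub_apply]
  have h0 : fderiv ℝ (fun z => fderiv ℝ (fun w => fderiv ℝ V w (EuclideanSpace.single 2 1) 0 *
          fderiv ℝ V w (EuclideanSpace.single 1 1) 2) z y -
        fderiv ℝ (fun w => fderiv ℝ V w (EuclideanSpace.single 2 1) 1 *
          fderiv ℝ V w (EuclideanSpace.single 0 1) 2) z y) x y = 0 := by
    rw [← hsplit, hF]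
    simp
  rw [fderiv_fun_sub (hDA x) (hDB x), _root_.sub_apply,
    fderiv_fderiv_mul_of_eq_zero hp0c hq1c hp0 hq1, fderiv_fderiv_mul_of_eq_zero hp1c hq0c hp1 hq0] at h0
  linarith

/-! ### (iii) linear dependence -/

/-- Two vectors `m, h ∈ ℝ³` (given by components) whose three `2×2` minors vanish are linearly dependent:
`∃ (c₁,c₂) ≠ 0, c₁ mⱼ = c₂ hⱼ` for `j = 0,1,2`. -/
theorem linearDependent_of_minors (m₀ m₁ m₂ h₀ h₁ h₂ : ℝ) (h01 : m₀ * h₁ - m₁ * h₀ = 0)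
    (h12 : m₁ * h₂ - m₂ * h₁ = 0) (h02 : m₀ * h₂ - m₂ * h₀ = 0) :
    ∃ c₁ c₂ : ℝ, (c₁ ≠ 0 ∨ c₂ ≠ 0) ∧ c₁ * m₀ = c₂ * h₀ ∧ c₁ * m₁ = c₂ * h₁ ∧ c₁ * m₂ = c₂ * h₂ := by
  by_cases hh0 : h₀ ≠ 0
  · exact ⟨h₀, m₀, Or.inl hh0, by ring, by linarith, by linarith⟩
  by_cases hh1 : h₁ ≠ 0
  · exact ⟨h₁, m₁, Or.inl hh1, by linarith, by ring, by linarith⟩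
  by_cases hh2 : h₂ ≠ 0
  · exact ⟨h₂, m₂, Or.inl hh2, by linarith, by linarith, by ring⟩
  rw [not_ne_iff] at hh0 hh1 hh2
  exact ⟨0, 1, Or.inr one_ne_zero, by simp [hh0], by simp [hh1], by simp [hh2]⟩

/-- **(iii) The shear Jacobian and the velocity Hessian are linearly dependent at a double zero of the
frozen law.**  `V ∈ C³` poloidal (`∂₀V₁ = ∂₁V₀`) with `∂_zV₀·∂₁V₂ − ∂_zV₁·∂₀V₂ ≡ 0`, and at `x` the pins
`∂_zV₀ = ∂_zV₁ = ∂₀V₂ = ∂₁V₂ = 0`.  Then `∃ (c₁,c₂) ≠ 0` with `c₁·∂_b∂_zV_a(x) = c₂·∂_b∂_aV₂(x)` for all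
`a, b ∈ {0,1}`. -/
theorem shear_hessian_dependent (hV : ContDiff ℝ 3 V)
    (hpol : ∀ y, fderiv ℝ V y (EuclideanSpace.single 0 1) 1 = fderiv ℝ V y (EuclideanSpace.single 1 1) 0)
    (hfrozen : ∀ y, fderiv ℝ V y (EuclideanSpace.single 2 1) 0 * fderiv ℝ V y (EuclideanSpace.single 1 1) 2 -
      fderiv ℝ V y (EuclideanSpace.single 2 1) 1 * fderiv ℝ V y (EuclideanSpace.single 0 1) 2 = 0)
    {x : EuclideanSpace ℝ (Fin 3)}
    (hp0 : fderiv ℝ V x (EuclideanSpace.single 2 1) 0 = 0) (hp1 : fderiv ℝ V x (EuclideanSpace.single 2 1) 1 = 0)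
    (hq0 : fderiv ℝ V x (EuclideanSpace.single 0 1) 2 = 0) (hq1 : fderiv ℝ V x (EuclideanSpace.single 1 1) 2 = 0) :
    ∃ c₁ c₂ : ℝ, (c₁ ≠ 0 ∨ c₂ ≠ 0) ∧ ∀ a b : Fin 3, a ≠ 2 → b ≠ 2 →
      c₁ * fderiv ℝ (fun z => fderiv ℝ V z (EuclideanSpace.single 2 1) a) x (EuclideanSpace.single b 1) =
        c₂ * fderiv ℝ (fun z => fderiv ℝ V z (EuclideanSpace.single a 1) 2) x (EuclideanSpace.single b 1) := by
  have hV2 : ContDiff ℝ 2 V := hV.of_le (by norm_num)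
  -- the entries
  set M00 := fderiv ℝ (fun z => fderiv ℝ V z (EuclideanSpace.single 2 1) 0) x (EuclideanSpace.single 0 1)
  set M01 := fderiv ℝ (fun z => fderiv ℝ V z (EuclideanSpace.single 2 1) 0) x (EuclideanSpace.single 1 1)
  set M10 := fderiv ℝ (fun z => fderiv ℝ V z (EuclideanSpace.single 2 1) 1) x (EuclideanSpace.single 0 1)
  set M11 := fderiv ℝ (fun z => fderiv ℝ V z (EuclideanSpace.single 2 1) 1) x (EuclideanSpace.single 1 1)
  set H00 := fderiv ℝ (fun z => fderiv ℝ V z (EuclideanSpace.single 0 1) 2) x (EuclideanSpace.single 0 1)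
  set H01 := fderiv ℝ (fun z => fderiv ℝ V z (EuclideanSpace.single 0 1) 2) x (EuclideanSpace.single 1 1)
  set H10 := fderiv ℝ (fun z => fderiv ℝ V z (EuclideanSpace.single 1 1) 2) x (EuclideanSpace.single 0 1)
  set H11 := fderiv ℝ (fun z => fderiv ℝ V z (EuclideanSpace.single 1 1) 2) x (EuclideanSpace.single 1 1)
  -- symmetries
  have hM : M01 = M10 := shearJacobian_symm hV2 hpol x
  have hH : H01 = H10 := fderiv_fderiv_apply_symm hV2 x (EuclideanSpace.single 0 1) (EuclideanSpace.single 1 1) 2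
  -- linearity of the entries in the direction
  have hlinM : ∀ a : Fin 3, fderiv ℝ (fun z => fderiv ℝ V z (EuclideanSpace.single 2 1) a) x
      (EuclideanSpace.single 0 1 + EuclideanSpace.single 1 1) =
      fderiv ℝ (fun z => fderiv ℝ V z (EuclideanSpace.single 2 1) a) x (EuclideanSpace.single 0 1) +
        fderiv ℝ (fun z => fderiv ℝ V z (EuclideanSpace.single 2 1) a) x (EuclideanSpace.single 1 1) :=
    fun a => map_add _ _ _
  have hlinH : ∀ a : Fin 3, fderiv ℝ (fun z => fderiv ℝ V z (EuclideanSpace.single a 1) 2) x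
      (EuclideanSpace.single 0 1 + EuclideanSpace.single 1 1) =
      fderiv ℝ (fun z => fderiv ℝ V z (EuclideanSpace.single a 1) 2) x (EuclideanSpace.single 0 1) +
        fderiv ℝ (fun z => fderiv ℝ V z (EuclideanSpace.single a 1) 2) x (EuclideanSpace.single 1 1) :=
    fun a => map_add _ _ _
  -- the three instances of `det[My, Hy] = 0`
  have d0 := det_shear_hessian_apply_eq_zero hV hfrozen hp0 hp1 hq0 hq1 (EuclideanSpace.single 0 1)
  have d1 := det_shear_hessian_apply_eq_zero hV hfrozen hp0 hp1 hq0 hq1 (EuclideanSpace.single 1 1)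
  have d2 := det_shear_hessian_apply_eq_zero hV hfrozen hp0 hp1 hq0 hq1
    (EuclideanSpace.single 0 1 + EuclideanSpace.single 1 1)
  rw [hlinM, hlinM, hlinH, hlinH] at d2
  -- in the entries: d0 : M00*H10 - M10*H00 = 0, d1 : M01*H11 - M11*H01 = 0,
  -- d2 : (M00+M01)(H10+H11) - (M10+M11)(H00+H01) = 0
  change M00 * H10 - M10 * H00 = 0 at d0
  change M01 * H11 - M11 * H01 = 0 at d1
  change (M00 + M01) * (H10 + H11) - (M10 + M11) * (H00 + H01) = 0 at d2
  -- the minors of m = (M00, M01, M11), h = (H00, H01, H11)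
  have e01 : M00 * H01 - M01 * H00 = 0 := by rw [hH, hM]; exact d0
  have e12 : M01 * H11 - M11 * H01 = 0 := d1
  have e02 : M00 * H11 - M11 * H00 = 0 := by
    rw [← hH, ← hM] at d2
    nlinarith [d2, e01, e12, hM, hH]
  obtain ⟨c₁, c₂, hne, c0, c1, c2⟩ := linearDependent_of_minors M00 M01 M11 H00 H01 H11 e01 e12 e02
  refine ⟨c₁, c₂, hne, fun a b ha hb => ?_⟩
  -- case analysis on the horizontal indices
  have ha' : a = 0 ∨ a = 1 := by
    rcases Fin.eq_zero_or_eq_succ a with h | ⟨j, rfl⟩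
    · exact Or.inl h
    · rcases Fin.eq_zero_or_eq_succ j with hj | ⟨k, rfl⟩
      · exact Or.inr (by rw [hj]; rfl)
      · exact absurd (by rw [Fin.eq_zero k]; rfl) ha
  have hb' : b = 0 ∨ b = 1 := by
    rcases Fin.eq_zero_or_eq_succ b with h | ⟨j, rfl⟩
    · exact Or.inl h
    · rcases Fin.eq_zero_or_eq_succ j with hj | ⟨k, rfl⟩
      · exact Or.inr (by rw [hj]; rfl)
      · exact absurd (by rw [Fin.eq_zero k]; rfl) hb
  rcases ha' with rfl | rfl <;> rcases hb' with rfl | rfl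
  · exact c0
  · exact c1
  · change c₁ * M10 = c₂ * H10
    rw [← hM, ← hH]; exact c1
  · exact c2

/-! ### Part A for the slice of a class profile -/

/-- **Part A of stub Z1 `stub_threadZeroStructure` (line `centre_type`) for the slice `v(−1)` of a poloidal
profile of the route's Type-I class at a thread**: with the thread pin `∇v₂(−1,0) = 0` and the loop-tangency pins
`∂_z v₀(−1,0) = ∂_z v₁(−1,0) = 0`, the shear Jacobian `M_ab = ∂_b∂_z v_a(−1,0)` is (i) symmetric, (ii) has trace
`−∂_z²v₂(−1,0)`, and (iii) is linearly dependent with the Hessian `H_ab = ∂_b∂_a v₂(−1,0)` (`a,b ∈ {0,1}`). -/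
theorem threadZeroStructure_partA {C : ℝ} {v : ℝ → EuclideanSpace ℝ (Fin 3) → EuclideanSpace ℝ (Fin 3)}
    (hrate : HasTypeITimeDecay C v)
    (hcont : ContinuousOn (uncurry v) (Iio (0 : ℝ) ×ˢ univ))
    (hmild : ∀ s t : ℝ, s < t → t < 0 → ∀ x,
      v t x = UnboundedOperators.heatExtension (v s) (t - s) x - oseenDuhamel 1 s v v t x)
    (hdiv : ∀ t < 0, VectorCalculus.IsDivFree (v t))
    (hpol : ∀ s < 0, ∀ y, ⟪curl (v s) y, EuclideanSpace.single 2 1⟫_ℝ = 0)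
    (hgrad : ∀ h : EuclideanSpace ℝ (Fin 3), fderiv ℝ (v (-1)) 0 h 2 = 0)
    (hpin : fderiv ℝ (v (-1)) 0 (EuclideanSpace.single 2 1) 0 = 0 ∧
      fderiv ℝ (v (-1)) 0 (EuclideanSpace.single 2 1) 1 = 0) :
    (fderiv ℝ (fun x => fderiv ℝ (v (-1)) x (EuclideanSpace.single 2 1) 0) 0 (EuclideanSpace.single 1 1) =
          fderiv ℝ (fun x => fderiv ℝ (v (-1)) x (EuclideanSpace.single 2 1) 1) 0 (EuclideanSpace.single 0 1) ∧
        fderiv ℝ (fun x => fderiv ℝ (v (-1)) x (EuclideanSpace.single 2 1) 0) 0 (EuclideanSpace.single 0 1) +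
            fderiv ℝ (fun x => fderiv ℝ (v (-1)) x (EuclideanSpace.single 2 1) 1) 0 (EuclideanSpace.single 1 1) =
          -fderiv ℝ (fun x => fderiv ℝ (v (-1)) x (EuclideanSpace.single 2 1) 2) 0 (EuclideanSpace.single 2 1)) ∧
      (∃ c₁ c₂ : ℝ, (c₁ ≠ 0 ∨ c₂ ≠ 0) ∧ ∀ a b : Fin 3, a ≠ 2 → b ≠ 2 →
          c₁ * fderiv ℝ (fun x => fderiv ℝ (v (-1)) x (EuclideanSpace.single 2 1) a) 0 (EuclideanSpace.single b 1) =
            c₂ * fderiv ℝ (fun x => fderiv ℝ (v (-1)) x (EuclideanSpace.single a 1) 2) 0 (EuclideanSpace.single b 1)) := by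
  -- smoothness of the slice
  have hA : IsTypeIAncientMild C v := isTypeIAncientMild_of_class hrate hcont hmild hdiv
  have hvs : ContDiff ℝ (⊤ : ℕ∞) (v (-1)) := hA.contDiff_slice (by norm_num)
  have hV3 : ContDiff ℝ 3 (v (-1)) := contDiff_infty.1 hvs 3
  have hV2 : ContDiff ℝ 2 (v (-1)) := contDiff_infty.1 hvs 2
  -- poloidality in components: `∂₀v₁ = ∂₁v₀`
  have hpol1 : ∀ y, fderiv ℝ (v (-1)) y (EuclideanSpace.single 0 1) 1 =
      fderiv ℝ (v (-1)) y (EuclideanSpace.single 1 1) 0 := fun y => by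
    have h := hpol (-1) (by norm_num) y
    have h' : curl (v (-1)) y 2 = 0 := by simpa [EuclideanSpace.inner_single_right] using h
    simpa [curl, sub_eq_zero] using h'
  -- the frozen law in components
  have hfrozen : ∀ y, fderiv ℝ (v (-1)) y (EuclideanSpace.single 2 1) 0 *
        fderiv ℝ (v (-1)) y (EuclideanSpace.single 1 1) 2 -
      fderiv ℝ (v (-1)) y (EuclideanSpace.single 2 1) 1 * fderiv ℝ (v (-1)) y (EuclideanSpace.single 0 1) 2 = 0 :=
    fun y => by
    have h := stub_firstIntegral C v hrate hcont hmild hdiv (EuclideanSpace.single 2 1) hpol (-1)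
      (by norm_num) y
    have h' : fderiv ℝ (v (-1)) y (curl (v (-1)) y) 2 = 0 := by
      simpa [EuclideanSpace.inner_single_right] using h
    rw [Summit.NavierStokesRegularity.NavierStokesRegularity.Theorems.PoloidalWindowDoorPoloidalWindowRigidityClebsch.fderiv_apply_curl_two] at h'
    have c0 : curl (v (-1)) y 0 = fderiv ℝ (v (-1)) y (EuclideanSpace.single 1 1) 2 -
        fderiv ℝ (v (-1)) y (EuclideanSpace.single 2 1) 1 := by simp [curl]
    have c1 : curl (v (-1)) y 1 = fderiv ℝ (v (-1)) y (EuclideanSpace.single 2 1) 0 -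
        fderiv ℝ (v (-1)) y (EuclideanSpace.single 0 1) 2 := by simp [curl]
    have c2 : curl (v (-1)) y 2 = 0 := by
      simpa [EuclideanSpace.inner_single_right] using hpol (-1) (by norm_num) y
    rw [c0, c1, c2] at h'
    linarith
  refine ⟨⟨shearJacobian_symm hV2 hpol1 0, shearJacobian_trace hV2 (hdiv (-1) (by norm_num)) 0⟩, ?_⟩
  exact shear_hessian_dependent hV3 hpol1 hfrozen hpin.1 hpin.2 (hgrad _) (hgrad _)

end Summit.NavierStokesRegularity.NavierStokesRegularity.Theorems.PoloidalWindowDoorPoloidalWindowRigidityThreadShearHessian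

end
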